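import Literature.AlgebraicGeometry.Resolution.IdealKernelPeeling
import Literature.AlgebraicGeometry.Resolution.ConormalSixTerm
import Literature.AlgebraicGeometry.Resolution.ExcCurveBiadditivityDisjoint
import Literature.AlgebraicGeometry.Resolution.ExceptionalCurveIntersectionH0
import HarnessLib

/-!
# Twist additivity `h⁰(𝒪/𝓛𝓗𝓘) + h⁰(𝒪/(𝓗+𝓘)) + h⁰(𝒪/𝓛) = h⁰(𝒪/𝓛𝓗) + h⁰(𝒪/𝓛𝓘)` on a rational resolution, and
# Lipman's cross-step `χ(𝒪_E(−L−F)) = χ(𝒪_E(−L)) − (F·E)` in `h⁰`-lengths (Lipman 1969, Prop. (13.1) b), d))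

Topic: `Literature/AlgebraicGeometry/Resolution`.  PROVED, fact-free, definition-free.  J. Lipman, *Rational
singularities …*, Publ. Math. IHÉS 36 (1969), §13, Prop. (13.1) b), d) (p. 223): "`(D·(E+F)) = (D·E) + (D·F)`",
"`(F·E) = χ(E) + χ(F) − χ(E+F)`", proved from the exact sequences `0 → 𝒪(−E)/𝒪(−E−F) → 𝒪_{E+F} → 𝒪_E → 0` and the
degree of `𝒪(−F)` on `E`.  On a resolution `π : X → Spec A` of a two-dimensional Noetherian local domain with
`H¹(X, 𝒪_X) = 0`, combining the conormal six-term identity (`Resolution/ConormalSixTerm`: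
`h0(𝓛𝓘) + ℓȞ¹(𝓛/𝓛𝓘) = h0 𝓛 + ℓΓ(𝓛/𝓛𝓘)`, applied to `𝓛` and to `𝓛𝓗`) with the peeling identity
(`Resolution/IdealKernelPeeling`: `ℓΓ(𝓛𝓗/𝓛𝓗𝓘) + h0(𝓗⊔𝓘) + ℓȞ¹(𝓛/𝓛𝓘) = ℓΓ(𝓛/𝓛𝓘) + ℓȞ¹(𝓛𝓗/𝓛𝓗𝓘)`) and cancelling the
(finite) `Γ`/`Ȟ¹` terms gives the TWIST ADDITIVITY

  `h0 π (𝓛𝓗𝓘) + h0 π (𝓗 ⊔ 𝓘) + h0 π 𝓛 = h0 π (𝓛𝓗) + h0 π (𝓛𝓘)`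

for `𝓛` invertible, `𝓗 ∩ 𝓘 ⊆ 𝓗𝓘`, `V(𝓗+𝓘)` finite and the four `h0`'s finite — i.e., with
`⟨𝓐,𝓑⟩ := h0 𝓐 + h0 𝓑 − h0(𝓐𝓑)` (Lipman's `(A·B)` in `h⁰`-form), `⟨𝓛𝓗, 𝓘⟩ = ⟨𝓛, 𝓘⟩ + ⟨𝓗, 𝓘⟩` whenever
`⟨𝓗, 𝓘⟩ = h0(𝓗 ⊔ 𝓘)` (curves without common component, inclusion–exclusion).  For `𝓛 = ∏_{ζ∈t} 𝓘_ζ` a product of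
exceptional primes, `𝓗 = 𝓘_F`, `𝓘 = 𝓘_E` (`E ≠ F`) this is the CROSS-STEP

  `h0(𝓛𝓘_F𝓘_E) − h0(𝓛𝓘_F) = h0(𝓛𝓘_E) − h0(𝓛) − (F·E)`   (`χ(𝒪_E(−L−F)) = χ(𝒪_E(−L)) − (F·E)`)

of the induction computing `h0(𝓛𝓘_E) − h0(𝓛) = h⁰(E) − (L·E)` (Riemann–Roch for exceptional line bundles on `E`,
whose SELF-STEP `F = E` is NOT covered here: it needs the moving part of a principal divisor, see
`Resolution/IdealKernelPeeling`).

* **`IsResolution.h0_twist_additivity`** — the displayed identity (general `𝓛`, `𝓗`, `𝓘`);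
* **`IsResolution.h0_prod_cross_step`** — the cross-step for exceptional products, in `ℤ`.

## References
* J. Lipman, Publ. Math. IHÉS 36 (1969), §13, Prop. (13.1) b), d) and proof (p. 223). [Lipman1969]
* R. Hartshorne, *Algebraic Geometry* (1977), III Thm. 4.5 proof (p. 222), V Prop. 1.4 / Ex. 1.1. [Hartshorne1977]
-/

noncomputable section

-- `TopCat.Presheaf`/`Scheme.Modules` are not reducible (as in Mathlib's `AlgebraicGeometry/Modules`).
set_option backward.isDefEq.respectTransparency false

open CategoryTheory CategoryTheory.Limits AlgebraicGeometry TopologicalSpace IsLocalRing Opposite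
open Literature.AlgebraicGeometry.Morphisms Literature.AlgebraicGeometry.Modules
open Literature.AlgebraicGeometry.Motives
open Scheme.IdealSheafData

universe u

namespace Literature.AlgebraicGeometry.Resolution

variable {A : Type u} [CommRing A] [IsNoetherianRing A] [IsLocalRing A] [IsDomain A]
  {X : Scheme.{u}} [IsIntegral X] [IsLocallyNoetherian X] (π : X ⟶ Spec (.of A))

omit [IsNoetherianRing A] [IsLocalRing A] [IsDomain A] [IsIntegral X] [IsLocallyNoetherian X] in
/-- A quasi-compact scheme has a finite affine open cover indexed by a type in its own universe. [folklore] -/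
private theorem exists_finite_isAffineOpen_cover'''' (X : Scheme.{u}) [CompactSpace X] :
    ∃ (κ : Type u) (_ : Finite κ) (U : κ → X.Opens), (∀ i, IsAffineOpen (U i)) ∧ ⨆ i, U i = ⊤ := by
  obtain ⟨s, hs, e⟩ := (isCompact_iff_finite_and_eq_biUnion_affineOpens (U := (⊤ : X.Opens))).mp
    (by simpa using isCompact_univ)
  haveI := hs.to_subtype
  refine ⟨s, inferInstance, fun i => i.1.1, fun i => i.1.2, ?_⟩
  rw [iSup_subtype]
  exact e.symm

omit [IsNoetherianRing A] [IsLocalRing A] [IsDomain A] [IsIntegral X] [IsLocallyNoetherian X] in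
/-- `a + b = c + d` in `ℕ∞` with all four finite gives the integer identity. [folklore] -/
private theorem toNat_add_eq_of_add_eq {a b c d : ℕ∞} (h : a + b = c + d) (ha : a ≠ ⊤) (hb : b ≠ ⊤) (hc : c ≠ ⊤)
    (hd : d ≠ ⊤) : a.toNat + b.toNat = c.toNat + d.toNat := by
  have h' := congrArg ENat.toNat h
  rwa [ENat.toNat_add ha hb, ENat.toNat_add hc hd] at h'

/-- **Twist additivity** `h⁰(𝒪/𝓛𝓗𝓘) + h⁰(𝒪/(𝓗+𝓘)) + h⁰(𝒪/𝓛) = h⁰(𝒪/𝓛𝓗) + h⁰(𝒪/𝓛𝓘)` on a resolution `π : X → Spec A`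
of a two-dimensional Noetherian local domain with `H¹(X, 𝒪_X) = 0`, for an invertible ideal sheaf `𝓛`, ideal sheaves
`𝓗`, `𝓘` with `𝓗 ∩ 𝓘 ⊆ 𝓗𝓘` and `V(𝓗 + 𝓘)` a finite set of closed points, all of `h0 𝓛`, `h0(𝓛𝓘)`, `h0(𝓛𝓗)`,
`h0(𝓛𝓗𝓘)` finite: Lipman's additivity of `χ` along `0 → 𝒪_C(−L−H) → 𝒪_C(−L) → 𝒪_{C∩H} → 0` (`C = V(𝓘)`) combined
with `χ(𝒪/𝓛𝓘) = χ(𝒪/𝓛) + χ(𝓛/𝓛𝓘)`, with `χ = h⁰` on quotients of `𝒪_X` (rational resolution). With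
`⟨𝓐,𝓑⟩ = h0 𝓐 + h0 𝓑 − h0(𝓐𝓑)` it reads `⟨𝓛𝓗,𝓘⟩ = ⟨𝓛,𝓘⟩ + h0(𝓗 ⊔ 𝓘)`.
[cite: Lipman1969, Proposition (13.1) b) and d), proof (p. 223)] -/
theorem IsResolution.h0_twist_additivity (hA : ringKrullDim A = 2) (hπ : IsResolution π) (h1 : HasTrivialCechH1 π)
    (𝓛 𝓗 𝓘 : X.IdealSheafData) (hL : IsEffectiveCartier 𝓛) (hHI : 𝓗 ⊓ 𝓘 ≤ 𝓗 * 𝓘)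
    {Z : Set X} (hZ : Z.Finite) (hZcl : ∀ p ∈ Z, IsClosed ({p} : Set X)) (hsupp : ((𝓗 ⊔ 𝓘).support : Set X) ⊆ Z)
    (hfL : h0 π 𝓛 ≠ ⊤) (hfLI : h0 π (𝓛 * 𝓘) ≠ ⊤) (hfLH : h0 π (𝓛 * 𝓗) ≠ ⊤) (hfLHI : h0 π (𝓛 * 𝓗 * 𝓘) ≠ ⊤) :
    h0 π (𝓛 * 𝓗 * 𝓘) + h0 π (𝓗 ⊔ 𝓘) + h0 π 𝓛 = h0 π (𝓛 * 𝓗) + h0 π (𝓛 * 𝓘) := by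
  haveI : IsProper π := hπ.isProper
  haveI : CompactSpace X := QuasiCompact.compactSpace_of_compactSpace π
  -- the quotient maps
  have hle₁ : 𝓛 * 𝓗 * 𝓘 ≤ 𝓛 * 𝓗 := fun U => Ideal.mul_le_right
  have hle₂ : 𝓛 * 𝓘 ≤ 𝓛 := fun U => Ideal.mul_le_right
  have hle₃ : 𝓛 * (𝓗 ⊔ 𝓘) ≤ 𝓛 := fun U => Ideal.mul_le_right
  have hlea : 𝓛 * 𝓗 * 𝓘 ≤ 𝓛 * 𝓘 := by
    intro U
    rw [ideal_mul, ideal_mul, ideal_mul, Pi.mul_apply, Pi.mul_apply, Pi.mul_apply]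
    exact Ideal.mul_mono_left Ideal.mul_le_right
  have hleb : 𝓛 * 𝓗 ≤ 𝓛 := fun U => Ideal.mul_le_right
  have hlec : 𝓛 * 𝓘 ≤ 𝓛 * (𝓗 ⊔ 𝓘) := by
    intro U
    rw [ideal_mul, ideal_mul, Pi.mul_apply, Pi.mul_apply, ideal_sup, Pi.sup_apply]
    exact Ideal.mul_mono_right le_sup_right
  let q₁ : idealQuot (unitModule X) (𝓛 * 𝓗 * 𝓘) ⟶ idealQuot (unitModule X) (𝓛 * 𝓗) :=
    idealQuotDesc ((isKilledBy_idealQuot (unitModule X) (𝓛 * 𝓗)).anti hle₁) (idealQuotπ _ _)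
  have hq₁ : idealQuotπ (unitModule X) (𝓛 * 𝓗 * 𝓘) ≫ q₁ = idealQuotπ (unitModule X) (𝓛 * 𝓗) :=
    idealQuotπ_desc _ _
  let q₂ : idealQuot (unitModule X) (𝓛 * 𝓘) ⟶ idealQuot (unitModule X) 𝓛 :=
    idealQuotDesc ((isKilledBy_idealQuot (unitModule X) 𝓛).anti hle₂) (idealQuotπ _ _)
  have hq₂ : idealQuotπ (unitModule X) (𝓛 * 𝓘) ≫ q₂ = idealQuotπ (unitModule X) 𝓛 := idealQuotπ_desc _ _
  let q₃ : idealQuot (unitModule X) (𝓛 * (𝓗 ⊔ 𝓘)) ⟶ idealQuot (unitModule X) 𝓛 :=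
    idealQuotDesc ((isKilledBy_idealQuot (unitModule X) 𝓛).anti hle₃) (idealQuotπ _ _)
  have hq₃ : idealQuotπ (unitModule X) (𝓛 * (𝓗 ⊔ 𝓘)) ≫ q₃ = idealQuotπ (unitModule X) 𝓛 := idealQuotπ_desc _ _
  let a : idealQuot (unitModule X) (𝓛 * 𝓗 * 𝓘) ⟶ idealQuot (unitModule X) (𝓛 * 𝓘) :=
    idealQuotDesc ((isKilledBy_idealQuot (unitModule X) (𝓛 * 𝓘)).anti hlea) (idealQuotπ _ _)
  have ha : idealQuotπ (unitModule X) (𝓛 * 𝓗 * 𝓘) ≫ a = idealQuotπ (unitModule X) (𝓛 * 𝓘) := idealQuotπ_desc _ _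
  let b : idealQuot (unitModule X) (𝓛 * 𝓗) ⟶ idealQuot (unitModule X) 𝓛 :=
    idealQuotDesc ((isKilledBy_idealQuot (unitModule X) 𝓛).anti hleb) (idealQuotπ _ _)
  have hb : idealQuotπ (unitModule X) (𝓛 * 𝓗) ≫ b = idealQuotπ (unitModule X) 𝓛 := idealQuotπ_desc _ _
  let c : idealQuot (unitModule X) (𝓛 * 𝓘) ⟶ idealQuot (unitModule X) (𝓛 * (𝓗 ⊔ 𝓘)) :=
    idealQuotDesc ((isKilledBy_idealQuot (unitModule X) (𝓛 * (𝓗 ⊔ 𝓘))).anti hlec) (idealQuotπ _ _)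
  have hc : idealQuotπ (unitModule X) (𝓛 * 𝓘) ≫ c = idealQuotπ (unitModule X) (𝓛 * (𝓗 ⊔ 𝓘)) :=
    idealQuotπ_desc _ _
  have w₁ : q₁ ≫ b = a ≫ q₂ := kernelPeel_sq₁ 𝓛 𝓗 𝓘 q₁ q₂ hq₁ hq₂ a ha b hb
  have w₂ : q₂ ≫ 𝟙 _ = c ≫ q₃ := kernelPeel_sq₂ 𝓛 𝓗 𝓘 q₂ q₃ hq₂ hq₃ c hc
  -- a finite affine cover
  obtain ⟨κ, _, U, hUaff, hUcov⟩ := exists_finite_isAffineOpen_cover'''' X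
  -- the three identities
  have eA₂ := hπ.h0_mul_add_length_cechMH1_kernel π hA h1 𝓛 𝓘 q₂ hq₂ U hUaff hUcov
  have eA₁ := hπ.h0_mul_add_length_cechMH1_kernel π hA h1 (𝓛 * 𝓗) 𝓘 q₁ hq₁ U hUaff hUcov
  have eB := length_kernelPeel π 𝓛 𝓗 𝓘 q₁ q₂ q₃ hq₁ hq₂ hq₃ a ha b c hc w₁ w₂ hL
    (mul_inf_mul_le_of_isEffectiveCartier 𝓛 𝓗 𝓘 hL hHI) hZ hZcl hsupp U hUaff hUcov
  -- finiteness of the `Γ` and `Ȟ¹` terms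
  set α₁ := Module.length A (MSections π (kernel q₁) ⊤) with hα₁
  set α₂ := Module.length A (MSections π (kernel q₂) ⊤) with hα₂
  set β₁ := Module.length A (CechMH1 π (kernel q₁) U) with hβ₁
  set β₂ := Module.length A (CechMH1 π (kernel q₂) U) with hβ₂
  have hα₂le : α₂ ≤ h0 π (𝓛 * 𝓘) := by
    rw [h0_eq_length_MSections_idealQuot]
    exact Module.length_le_of_injective (MSections.app π (kernel.ι q₂) ⊤) (kernel_ι_app_injective q₂ ⊤)
  have hα₁le : α₁ ≤ h0 π (𝓛 * 𝓗 * 𝓘) := by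
    rw [h0_eq_length_MSections_idealQuot]
    exact Module.length_le_of_injective (MSections.app π (kernel.ι q₁) ⊤) (kernel_ι_app_injective q₁ ⊤)
  have hα₂ : α₂ ≠ ⊤ := ne_top_of_le_ne_top hfLI hα₂le
  have hα₁ : α₁ ≠ ⊤ := ne_top_of_le_ne_top hfLHI hα₁le
  have hβ₂ : β₂ ≠ ⊤ := by
    refine ne_top_of_le_ne_top (WithTop.add_ne_top.mpr ⟨hfL, hα₂⟩) ?_
    rw [← eA₂]
    exact le_add_self
  have hβ₁ : β₁ ≠ ⊤ := by
    refine ne_top_of_le_ne_top (WithTop.add_ne_top.mpr ⟨hfLH, hα₁⟩) ?_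
    rw [← eA₁]
    exact le_add_self
  have hsupfin : h0 π (𝓗 ⊔ 𝓘) ≠ ⊤ := by
    refine ne_top_of_le_ne_top (WithTop.add_ne_top.mpr ⟨hα₂, hβ₁⟩) ?_
    rw [← eB]
    exact le_trans le_add_self le_self_add
  -- pass to natural numbers and cancel
  have nA₂ := toNat_add_eq_of_add_eq eA₂ hfLI hβ₂ hfL hα₂
  have nA₁ := toNat_add_eq_of_add_eq eA₁ hfLHI hβ₁ hfLH hα₁
  have nB : α₁.toNat + (h0 π (𝓗 ⊔ 𝓘)).toNat + β₂.toNat = α₂.toNat + β₁.toNat := by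
    have h' := congrArg ENat.toNat eB
    rwa [ENat.toNat_add (WithTop.add_ne_top.mpr ⟨hα₁, hsupfin⟩) hβ₂, ENat.toNat_add hα₁ hsupfin,
      ENat.toNat_add hα₂ hβ₁] at h'
  have key : (h0 π (𝓛 * 𝓗 * 𝓘)).toNat + (h0 π (𝓗 ⊔ 𝓘)).toNat + (h0 π 𝓛).toNat =
      (h0 π (𝓛 * 𝓗)).toNat + (h0 π (𝓛 * 𝓘)).toNat := by
    omega
  rw [← ENat.coe_toNat hfLHI, ← ENat.coe_toNat hsupfin, ← ENat.coe_toNat hfL, ← ENat.coe_toNat hfLH,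
    ← ENat.coe_toNat hfLI]
  exact_mod_cast key

/-- **Lipman's cross-step `χ(𝒪_E(−L−F)) = χ(𝒪_E(−L)) − (F·E)` in `h⁰`-lengths**: on a resolution `π : X → Spec A`
of a two-dimensional Noetherian local domain with `H¹(X, 𝒪_X) = 0`, for `𝓛 = ∏_{ζ∈t} 𝓘_ζ` a product of prime ideals
of integral exceptional curves and two DISTINCT integral exceptional curves `F = E_{η′}`, `E = E_η`,
`h0(𝓛𝓘_{η′}𝓘_η) − h0(𝓛𝓘_{η′}) = h0(𝓛𝓘_η) − h0(𝓛) − (F·E)` (integers; `(F·E) = excCurveDegree π [F] η = h⁰(𝒪_{E∩F})`).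
Summed over the factors of `𝓛` avoiding `η` this is `h0(𝓛𝓘_η) − h0(𝓛) = h⁰(E) − (L·E)`, the degree formula behind
Prop. (13.1) b), d); the factors `𝓘_η` of `𝓛` (self-intersection) are NOT treated here.
[cite: Lipman1969, Proposition (13.1) b) and d), proof (p. 223)] -/
theorem IsResolution.h0_prod_cross_step (hA : ringKrullDim A = 2) (hπ : IsResolution π) (h1 : HasTrivialCechH1 π)
    (t : Multiset X) (ht : ∀ ζ ∈ t, ζ ∈ excCurvePoints π) {η η' : X} (hη : η ∈ excCurvePoints π)
    (hη' : η' ∈ excCurvePoints π) (hne : η ≠ η') (hF : IsEffectiveCartier (primeDivisorIdeal η')) :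
    let 𝓛 : X.IdealSheafData := (t.map primeDivisorIdeal).prod
    ((h0 π (𝓛 * primeDivisorIdeal η' * primeDivisorIdeal η)).toNat : ℤ) - (h0 π (𝓛 * primeDivisorIdeal η')).toNat =
      ((h0 π (𝓛 * primeDivisorIdeal η)).toNat : ℤ) - (h0 π 𝓛).toNat -
        excCurveDegree π (CartierDivisor.ofIsEffectiveCartier (primeDivisorIdeal η') hF) η := by
  intro 𝓛
  classical
  haveI : IsProper π := hπ.isProper
  haveI : IsNoetherian X := by
    haveI : CompactSpace X := QuasiCompact.compactSpace_of_compactSpace π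
    exact {}
  have hX : Scheme.IsRegular X := hπ.isRegular
  have hco : ∀ ζ ∈ excCurvePoints π, Order.coheight ζ = 1 := fun ζ hζ => hπ.coheight_eq_one_of_mem_excCurvePoints hA hζ
  have hL : IsEffectiveCartier 𝓛 := isEffectiveCartier_prod_primeDivisorIdeal hX t fun ζ hζ => hco ζ (ht ζ hζ)
  -- `𝓘_F ∩ 𝓘_E = 𝓘_F 𝓘_E`, `V(𝓘_F + 𝓘_E) ⊆ F ∩ E` finite, closed points
  have hHI : primeDivisorIdeal η' ⊓ primeDivisorIdeal η ≤ primeDivisorIdeal η' * primeDivisorIdeal η :=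
    (hπ.primeDivisorIdeal_inf_eq_mul hA hη' hη (Ne.symm hne)).le
  set Zs : Set X := closure ({η'} : Set X) ∩ closure {η} with hZs
  have hZ : Zs.Finite := finite_closure_inter_closure_of_height_le_one hη'.2.le hη.2.le (Ne.symm hne)
  have hZcl : ∀ p ∈ Zs, IsClosed ({p} : Set X) := fun p hp =>
    isClosed_singleton_of_mem_closure_inter hη'.2.le hη.2.le (Ne.symm hne) hp
  have hsupp : ((primeDivisorIdeal η' ⊔ primeDivisorIdeal η).support : Set X) ⊆ Zs :=
    coe_support_primeDivisorIdeal_sup η' η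
  -- finiteness of the four `h0`: all are `h0` of products of exceptional primes
  have hprod : ∀ a b : Multiset X, ((a.map primeDivisorIdeal).prod * (b.map primeDivisorIdeal).prod : X.IdealSheafData) =
      ((a + b).map primeDivisorIdeal).prod := fun a b => by rw [Multiset.map_add, Multiset.prod_add]
  have hsing : ∀ ζ : X, primeDivisorIdeal ζ = ((({ζ} : Multiset X)).map primeDivisorIdeal).prod := fun ζ => by
    rw [Multiset.map_singleton, Multiset.prod_singleton]
  have hmem₁ : ∀ ζ ∈ t + {η}, ζ ∈ excCurvePoints π := fun ζ hζ =>
    (Multiset.mem_add.mp hζ).elim (ht ζ) fun h => by rw [Multiset.mem_singleton.mp h]; exact hη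
  have hmem₂ : ∀ ζ ∈ t + {η'}, ζ ∈ excCurvePoints π := fun ζ hζ =>
    (Multiset.mem_add.mp hζ).elim (ht ζ) fun h => by rw [Multiset.mem_singleton.mp h]; exact hη'
  have hmem₃ : ∀ ζ ∈ t + {η'} + {η}, ζ ∈ excCurvePoints π := fun ζ hζ =>
    (Multiset.mem_add.mp hζ).elim (hmem₂ ζ) fun h => by rw [Multiset.mem_singleton.mp h]; exact hη
  have hfL : h0 π 𝓛 ≠ ⊤ := h0_prod_primeDivisorIdeal_ne_top (π := π) t ht
  have hfLI : h0 π (𝓛 * primeDivisorIdeal η) ≠ ⊤ := by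
    change h0 π ((t.map primeDivisorIdeal).prod * primeDivisorIdeal η) ≠ ⊤
    rw [hsing η, hprod]
    exact h0_prod_primeDivisorIdeal_ne_top _ hmem₁
  have hfLH : h0 π (𝓛 * primeDivisorIdeal η') ≠ ⊤ := by
    change h0 π ((t.map primeDivisorIdeal).prod * primeDivisorIdeal η') ≠ ⊤
    rw [hsing η', hprod]
    exact h0_prod_primeDivisorIdeal_ne_top _ hmem₂
  have hfLHI : h0 π (𝓛 * primeDivisorIdeal η' * primeDivisorIdeal η) ≠ ⊤ := by
    change h0 π ((t.map primeDivisorIdeal).prod * primeDivisorIdeal η' * primeDivisorIdeal η) ≠ ⊤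
    rw [hsing η', hprod, hsing η, hprod]
    exact h0_prod_primeDivisorIdeal_ne_top _ hmem₃
  have htw := hπ.h0_twist_additivity π hA h1 𝓛 (primeDivisorIdeal η') (primeDivisorIdeal η) hL hHI hZ hZcl hsupp
    hfL hfLI hfLH hfLHI
  -- `h0(𝓘_F + 𝓘_E) = (F·E)`
  obtain ⟨hfin, hsup⟩ := toNat_h0_sup_eq_excCurveDegree hπ hη hη' hne hF
  rw [sup_comm] at hfin hsup
  have key : (h0 π (𝓛 * primeDivisorIdeal η' * primeDivisorIdeal η)).toNat +
      (h0 π (primeDivisorIdeal η' ⊔ primeDivisorIdeal η)).toNat + (h0 π 𝓛).toNat =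
        (h0 π (𝓛 * primeDivisorIdeal η')).toNat + (h0 π (𝓛 * primeDivisorIdeal η)).toNat := by
    have h' := congrArg ENat.toNat htw
    rwa [ENat.toNat_add (WithTop.add_ne_top.mpr ⟨hfLHI, hfin⟩) hfL, ENat.toNat_add hfLHI hfin,
      ENat.toNat_add hfLH hfLI] at h'
  rw [← hsup]
  omega

end Literature.AlgebraicGeometry.Resolution

end
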